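/-
Copyright (c) 2026 the pub-hodgecm-mathlib formalisation cell (harness21).  Prover seat hodgecm-mathlib-K2Liu-p14 (g4) (writer of record of the (K1b-♮)
package ★ p863141 `K2LiuKindOneLineTermPackage`, K1b∕ρ desk; LEAD F0P6-plan (g14) BATCH #139 (1)), Track B «K2-LIT» ∕ hLiu418 #184♮, socket #41 KIND 1:
(P-supp) THE INTRINSIC SUPPORT LETTER OF THE MIDDLE-CELL TERM FROM THE LEVEL, THE `REST`-CELL INVARIANCE AND THE LATTICE LETTERS.  THEOREMS ONLY.
-/
import Summits.HodgeConjecture.HodgeConjecture.Theorems.K2LiuFourierCoeffDeltaRightTranslate        -- ★ p863175 (ρ1) `fourierCoeffDelta_eq_zero_of_right_invariant`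
import Summits.HodgeConjecture.HodgeConjecture.Theorems.K2LiuMiddleCellFunctionRightInvariant      -- ★ p863075 (ρ2) `tsum_cellFunction_rightInvariant_HA`
import Summits.HodgeConjecture.HodgeConjecture.Theorems.K2LiuSiegelEisensteinMiddleTermContinuous  -- ★ `continuous_tsum_rest` (the `REST`-cell sum is continuous, `n∕2 < re s`)
import Summits.HodgeConjecture.HodgeConjecture.Theorems.K2LiuSiegelEisensteinKindWInstance         -- ★ `hsupp_of_local` (per-place lattice letters ⇒ a global denominator)
import HarnessLib

/-!
# Crux `HLiu418`, socket #41, KIND 1 — (P-supp) `K2LiuKindOneLineSupportIntrinsic`: THE SUPPORT LETTER OF THE MIDDLE-CELL TERM, INTRINSICALLY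

Cell `hodgecm-mathlib`, crux item hLiu418 = `stmt-HodgeConjecture-24832` (helper lane `--supports … --as helper`, count-neutral), route of record
`HCCMUnconditional`; squad K2 ∕ K2Liu, road `K2_Liu`, socket #41 `sig_K2LiuSiegelEisensteinContinuation`, KIND 1, block K1-b♮ (package writer ∕ desk K2Liu-p14 (g4),
★ p863141 `K2LiuKindOneLineTermPackage.exists_kindOne_lineTermPackage_of_letters`: the letter (supp½) `Cb κb hCb hκb hsupp` ON `{n∕2 < re s}`).

THE MATHEMATICS [MoeglinWaldspurger1995, I.2.6, II.1.7], [Shimura1997, §18.1, §18.4 Prop. 18.14], [KudlaRallis1994, §2].  The middle-cell term of the `S`-th Fourier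
coefficient of the Siegel Eisenstein series is the normalised `ψ_S`-coefficient `φ_S(h) = (∫β)⁻¹ ∫_{N_Δ(𝔸)} β(u) conj ψ_S(u) Φ_s(u h) du` of the `REST`-cell function
`Φ_s(x) = Σ'_{q ∈ REST} f_s(γ_q x)` (the cosets `P_Δ(L⁺)\H(L⁺)` other than `[1]` and the big cell `[w_Δ ν]`).  `Φ_s` is continuous (`n∕2 < re s`, ★ `continuous_tsum_rest`),
left-`N_Δ(L⁺)`-invariant (the letter `hrestL`: right multiplication by `ν ∈ N_Δ(L⁺)` permutes `REST`), and RIGHT-invariant under every `b ∈ N_Δ(𝔸)` with `h⁻¹ b h` in the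
level `K_f` of the family (★ (ρ2) `tsum_cellFunction_rightInvariant_HA`).  By the `N_Δ(𝔸)`-equivariance of `φ_S` (★ (ρ1)), `φ_S(h) ≠ 0` forces `ψ_S(b) = 1` for every such
`b` — an INTRINSIC lattice condition on `S` (no orbit representative, no Levi chart), which the letter `hlat` ((ρ3) elementary test matrices + (ρ5) congruence level + ★ (c1)
local-height conjugation, typed by the (K1b-W) hands) converts into per-place valuation bounds `|S_{ab}|_w ≤ q_w^{m_w}`, `q_w^{m_w} ≤ q_w^{δ_w} H_w(h)^k`; ★ `hsupp_of_local` turns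
those into ONE denominator `D ≤ Cb · H(h)^κb` with `D · S` integral, `Cb κb` depending on the level only.
* §1 `exists_bound_of_leftInvariant` — a continuous left-`N_Δ(L⁺)`-invariant function on `N_Δ(𝔸)` is bounded, given a compactly supported covering weight.
* §2 `unipDeltaChar_eq_one_of_coeff_ne_zero` — `φ_S(h) ≠ 0` ⇒ `ψ_S ≡ 1` on `{b ∈ N_Δ(𝔸) : h⁻¹ b h ∈ K_f}` (★ (ρ1) + ★ (ρ2) + ★ `continuous_tsum_rest` + §1).
* §3 **`hsupp_middle_of_letters`** — the (supp½) letter of ★ p863141 for the TOP's normalised middle-cell term (its `hpin` left-hand side, byte for byte), from the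
  level letter `(Kf, hKf)`, the invariance letter `hrestL` and the lattice letter `(Tδ δ hδ k, hlat)`, all BY VALUE (payers: (ρ7), (ρ8), (P-supp-lat)).
HONEST LABEL.  Count-neutral helper; it closes no socket by itself: `HC_CM` is proved only modulo the 7 printed citations (2 remaining named inputs: hLiu418 =
`stmt-HodgeConjecture-24832`, h413 = `stmt-HodgeConjecture-24833`) until rung 0 closes.

## References
* [MoeglinWaldspurger1995] C. Mœglin, J.-L. Waldspurger, *Spectral decomposition and Eisenstein series* (1995): I.2.6, II.1.7.
* [Shimura1997] G. Shimura, *Euler products and Eisenstein series*, CBMS 93 (1997): §18.1, §18.4 Prop. 18.14.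
* [KudlaRallis1994] S. Kudla, S. Rallis, Ann. of Math. 140 (1994): §2.
-/

set_option autoImplicit false
-- the mandated namespace repeats the single-problem summit's segment (`HodgeConjecture.HodgeConjecture`)
set_option linter.dupNamespace false

noncomputable section

open scoped Matrix ENNReal NNReal Topology ComplexConjugate
open NumberField IsDedekindDomain MeasureTheory MeasureTheory.Measure Filter Set Function
open Literature.NumberTheory.Automorphic Literature.NumberTheory.Automorphic.UnitaryGroup Literature.NumberTheory.GaloisRepresentations
open Literature.NumberTheory.GelbartRogawski1991 Literature.NumberTheory.GelbartRogawski1991.GRConstruction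
open Literature.NumberTheory.K2Lit.SiegelDoubled Literature.MeasureTheory.Group

namespace Summit.HodgeConjecture.HodgeConjecture.Cruxes.HLiu418.K2LiuKindOneLineSupportIntrinsic

open K2LiuSiegelUnipotentFourierDefs K2LiuSiegelUnipotentCharacters K2LiuUnipotentCoveringWeight K2LiuSiegelFourierCoeffDelta
open K2LiuFourierCoeffDeltaRightTranslate (fourierCoeffDelta_eq_zero_of_right_invariant)
open K2LiuMiddleCellFunctionRightInvariant (tsum_cellFunction_rightInvariant_HA)
open K2LiuSiegelEisensteinMiddleTermContinuous (continuous_tsum_rest)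
open K2LiuSiegelEisensteinKindWInstance (hsupp_of_local)

variable (L : Type) [Field L] [NumberField L] [IsCMField L]
variable {N M n : ℕ} (e : Fin N × Fin M ≃ Fin n)
  (dV : Fin N → L) (hdV : ∀ i, IsCMField.complexConj L (dV i) = dV i)
  (dW : Fin M → L) (hdW : ∀ i, IsCMField.complexConj L (dW i) = dW i)
  [MeasurableSpace (unipDelta L e dV hdV dW hdW)] [BorelSpace (unipDelta L e dV hdV dW hdW)]

/-! ## §1 A continuous left-`N_Δ(L⁺)`-invariant function on `N_Δ(𝔸)` is bounded -/

omit [BorelSpace (unipDelta L e dV hdV dW hdW)] in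
/-- **BOUNDEDNESS FROM LEFT-INVARIANCE**: `g` continuous on `N_Δ(𝔸)` and left-`N_Δ(L⁺)`-invariant, `β` a covering weight for `N_Δ(L⁺)` with `β ≤ 𝟙_K`, `K` compact ⇒
`‖g‖ ≤ C` on all of `N_Δ(𝔸)` (every `u` has a translate `γ u ∈ K`, since `Σ_γ β(γ u) = 1`). [cite: MoeglinWaldspurger1995, I.2.6] [folklore] -/
theorem exists_bound_of_leftInvariant {g : unipDelta L e dV hdV dW hdW → ℂ} (hgc : Continuous g)
    (hg : ∀ (γ : unipDeltaRat L e dV hdV dW hdW) (u : unipDelta L e dV hdV dW hdW), g ((γ : unipDelta L e dV hdV dW hdW) * u) = g u)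
    {β : unipDelta L e dV hdV dW hdW → ℝ≥0∞} (hβ : IsCoveringWeight (unipDeltaRat L e dV hdV dW hdW) β)
    {K : Set (unipDelta L e dV hdV dW hdW)} (hK : IsCompact K) (hβK : ∀ u, β u ≤ K.indicator 1 u) :
    ∃ C : ℝ, ∀ u : unipDelta L e dV hdV dW hdW, ‖g u‖ ≤ C := by
  obtain ⟨C, hC⟩ := hK.exists_bound_of_continuousOn hgc.continuousOn
  refine ⟨C, fun u => ?_⟩
  -- some translate `γ • u` lies in `K`
  have hsum : (∑' γ : unipDeltaRat L e dV hdV dW hdW, β (γ • u)) = 1 := by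
    rw [← coveringSum_apply]; exact hβ.coveringSum_eq u
  obtain ⟨γ, hγ⟩ : ∃ γ : unipDeltaRat L e dV hdV dW hdW, β (γ • u) ≠ 0 := by
    by_contra hall
    push Not at hall
    rw [ENNReal.tsum_eq_zero.2 hall] at hsum
    exact zero_ne_one hsum
  have hmem : γ • u ∈ K := by
    by_contra hnot
    have hle := hβK (γ • u)
    rw [Set.indicator_of_notMem hnot] at hle
    exact hγ (nonpos_iff_eq_zero.1 hle)
  have hγu : γ • u = (γ : unipDelta L e dV hdV dW hdW) * u := by rw [Subgroup.smul_def, smul_eq_mul]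
  rw [← hg γ u, ← hγu]
  exact hC _ hmem

/-! ## §2 `φ_S(h) ≠ 0` forces `ψ_S ≡ 1` on the conjugated level -/

/-- **THE VANISHING PRINCIPLE, CONTRAPOSED** (`n∕2 < re s`, `χ` unitary, `f_s ∈ I_Δ(s, χ)` continuous, RIGHT-invariant under the level `K_f ≤ H(𝔸)`, the `REST`-cell sum
left-`N_Δ(L⁺)`-invariant): if the normalised `ψ_S`-coefficient `φ_S(h)` of `Φ_s = Σ'_{q ∈ REST} f_s(γ_q ·)` is `≠ 0`, then `ψ_S(b) = 1` for every `b ∈ N_Δ(𝔸)` with `h⁻¹ b h ∈ K_f`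
(★ (ρ2): `Φ_s` is right-`b`-invariant at `h`; ★ (ρ1): a right-`b`-invariant coefficient with `ψ_S(b) ≠ 1` vanishes; continuity ★ `continuous_tsum_rest`, boundedness §1).
[cite: MoeglinWaldspurger1995, I.2.6, II.1.7] [cite: Shimura1997, §18.1] -/
theorem unipDeltaChar_eq_one_of_coeff_ne_zero (hdV0 : ∀ i, dV i ≠ 0) (hdW0 : ∀ i, dW i ≠ 0)
    {χ : HeckeCharacter L} (hχ : χ.IsUnitary) {s : ℂ} (hs : (n : ℝ) / 2 < s.re)
    {f : ℂ → HA L e dV hdV dW hdW → ℂ} (hfΔ : IsSiegelDeltaSection L e dV hdV dW hdW χ s (f s)) (hfc : Continuous (f s))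
    (νN : Measure (unipDelta L e dV hdV dW hdW)) [νN.IsMulLeftInvariant]
    {β : unipDelta L e dV hdV dW hdW → ℝ≥0∞} (hβ : IsCoveringWeight (unipDeltaRat L e dV hdV dW hdW) β) (hβtop : ∫⁻ u, β u ∂νN ≠ ∞)
    {K : Set (unipDelta L e dV hdV dW hdW)} (hK : IsCompact K) (hβK : ∀ u, β u ≤ K.indicator 1 u)
    (wq : unipDeltaRat L e dV hdV dW hdW → ratH L e dV hdV dW hdW)
    -- the level of the section (by value)
    (Kf : Subgroup (HA L e dV hdV dW hdW)) (hKf : ∀ (x k : HA L e dV hdV dW hdW), k ∈ Kf → f s (x * k) = f s x)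
    -- the `REST`-cell sum is left-`N_Δ(L⁺)`-invariant (by value)
    (hrestL : ∀ (γ : unipDeltaRat L e dV hdV dW hdW) (x : HA L e dV hdV dW hdW),
      (∑' q : ↥(({Quotient.mk (MulAction.orbitRel (siegelDeltaRat L e dV hdV dW hdW) (ratH L e dV hdV dW hdW)) 1} ∪
            Set.range (fun ν : unipDeltaRat L e dV hdV dW hdW =>
              (Quotient.mk (MulAction.orbitRel (siegelDeltaRat L e dV hdV dW hdW) (ratH L e dV hdV dW hdW)) (wq ν) :
                SiegelDeltaQuot L e dV hdV dW hdW)))ᶜ : Set (SiegelDeltaQuot L e dV hdV dW hdW)),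
          f s ((((Quotient.out (q : SiegelDeltaQuot L e dV hdV dW hdW) : ratH L e dV hdV dW hdW) : HA L e dV hdV dW hdW)) *
            ((((γ : unipDelta L e dV hdV dW hdW)) : HA L e dV hdV dW hdW) * x))) =
        ∑' q : ↥(({Quotient.mk (MulAction.orbitRel (siegelDeltaRat L e dV hdV dW hdW) (ratH L e dV hdV dW hdW)) 1} ∪
            Set.range (fun ν : unipDeltaRat L e dV hdV dW hdW =>
              (Quotient.mk (MulAction.orbitRel (siegelDeltaRat L e dV hdV dW hdW) (ratH L e dV hdV dW hdW)) (wq ν) :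
                SiegelDeltaQuot L e dV hdV dW hdW)))ᶜ : Set (SiegelDeltaQuot L e dV hdV dW hdW)),
          f s ((((Quotient.out (q : SiegelDeltaQuot L e dV hdV dW hdW) : ratH L e dV hdV dW hdW) : HA L e dV hdV dW hdW)) * x))
    (S : Matrix (Fin n) (Fin n) L) (h : HA L e dV hdV dW hdW)
    (hne : fourierCoeffDelta L e dV hdV dW hdW νN β S
      (fun x => ∑' q : ↥(({Quotient.mk (MulAction.orbitRel (siegelDeltaRat L e dV hdV dW hdW) (ratH L e dV hdV dW hdW)) 1} ∪
            Set.range (fun ν : unipDeltaRat L e dV hdV dW hdW =>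
              (Quotient.mk (MulAction.orbitRel (siegelDeltaRat L e dV hdV dW hdW) (ratH L e dV hdV dW hdW)) (wq ν) :
                SiegelDeltaQuot L e dV hdV dW hdW)))ᶜ : Set (SiegelDeltaQuot L e dV hdV dW hdW)),
          f s ((((Quotient.out (q : SiegelDeltaQuot L e dV hdV dW hdW) : ratH L e dV hdV dW hdW) : HA L e dV hdV dW hdW)) * x)) h ≠ 0)
    (b : unipDelta L e dV hdV dW hdW) (hb : h⁻¹ * (b : HA L e dV hdV dW hdW) * h ∈ Kf) :
    unipDeltaChar L e dV hdV dW hdW S (b : HA L e dV hdV dW hdW) = 1 := by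
  -- the `REST`-cell function
  set Φ : HA L e dV hdV dW hdW → ℂ := fun x =>
    ∑' q : ↥(({Quotient.mk (MulAction.orbitRel (siegelDeltaRat L e dV hdV dW hdW) (ratH L e dV hdV dW hdW)) 1} ∪
          Set.range (fun ν : unipDeltaRat L e dV hdV dW hdW =>
            (Quotient.mk (MulAction.orbitRel (siegelDeltaRat L e dV hdV dW hdW) (ratH L e dV hdV dW hdW)) (wq ν) :
              SiegelDeltaQuot L e dV hdV dW hdW)))ᶜ : Set (SiegelDeltaQuot L e dV hdV dW hdW)),
        f s ((((Quotient.out (q : SiegelDeltaQuot L e dV hdV dW hdW) : ratH L e dV hdV dW hdW) : HA L e dV hdV dW hdW)) * x) with hΦ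
  by_contra hSb
  apply hne
  -- continuity of `u ↦ Φ (u h)` along `N_Δ(𝔸)` (★ `continuous_tsum_rest`)
  have hΦc : Continuous Φ := continuous_tsum_rest L e dV hdV dW hdW hdV0 hdW0 hχ hs hfΔ hfc wq
  have hφc : Continuous fun u : unipDelta L e dV hdV dW hdW => Φ ((u : HA L e dV hdV dW hdW) * h) :=
    hΦc.comp (continuous_subtype_val.mul continuous_const)
  -- left-`N_Δ(L⁺)`-invariance along `N_Δ(𝔸)·h` (the letter `hrestL`)
  have hφ : ∀ (γ : unipDeltaRat L e dV hdV dW hdW) (u : unipDelta L e dV hdV dW hdW),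
      Φ ((((γ : unipDelta L e dV hdV dW hdW) * u : unipDelta L e dV hdV dW hdW) : HA L e dV hdV dW hdW) * h) = Φ ((u : HA L e dV hdV dW hdW) * h) := by
    intro γ u
    simp only [hΦ, Subgroup.coe_mul, mul_assoc]
    exact hrestL γ ((u : HA L e dV hdV dW hdW) * h)
  -- boundedness (§1)
  have hφb : ∃ C, ∀ u : unipDelta L e dV hdV dW hdW, ‖Φ ((u : HA L e dV hdV dW hdW) * h)‖ ≤ C :=
    exists_bound_of_leftInvariant L e dV hdV dW hdW hφc hφ hβ hK hβK
  -- right-invariance under `b` at `h` (★ (ρ2))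
  have hbR : ∀ u : unipDelta L e dV hdV dW hdW, Φ ((u : HA L e dV hdV dW hdW) * (b : HA L e dV hdV dW hdW) * h) = Φ ((u : HA L e dV hdV dW hdW) * h) := by
    intro u
    have key := tsum_cellFunction_rightInvariant_HA L e dV hdV dW hdW (K := Kf) (f := f s) hKf
      (fun q : ↥(({Quotient.mk (MulAction.orbitRel (siegelDeltaRat L e dV hdV dW hdW) (ratH L e dV hdV dW hdW)) 1} ∪
          Set.range (fun ν : unipDeltaRat L e dV hdV dW hdW =>
            (Quotient.mk (MulAction.orbitRel (siegelDeltaRat L e dV hdV dW hdW) (ratH L e dV hdV dW hdW)) (wq ν) :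
              SiegelDeltaQuot L e dV hdV dW hdW)))ᶜ : Set (SiegelDeltaQuot L e dV hdV dW hdW)) =>
        (((Quotient.out (q : SiegelDeltaQuot L e dV hdV dW hdW) : ratH L e dV hdV dW hdW) : HA L e dV hdV dW hdW)))
      (u : HA L e dV hdV dW hdW) h (b := (b : HA L e dV hdV dW hdW)) hb
    simp only [hΦ, mul_assoc] at key ⊢
    exact key
  exact fourierCoeffDelta_eq_zero_of_right_invariant L e dV hdV dW hdW νN hβ hβtop S hφc hφb hφ b hbR hSb

/-! ## §3 The (supp½) letter of the K1-b♮ package for the middle-cell term, from the three letters -/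

/-- **(P-supp) THE SUPPORT LETTER OF THE NORMALISED MIDDLE-CELL TERM, INTRINSICALLY** (`0 < n`, `χ` unitary, `f_s ∈ I_Δ(s, χ)` continuous for every `s`, the TOP's carrier
`(νN, β ≤ 𝟙_K)` and `wq`).  BY VALUE: the LEVEL `(Kf, hKf)` of the family (one level for all `s` — payer (ρ7)), the left-`N_Δ(L⁺)`-INVARIANCE `hrestL` of the `REST`-cell
sum (payer (ρ8)), and the LATTICE LETTER `hlat`: whenever `ψ_S ≡ 1` on `{b ∈ N_Δ(𝔸) : h⁻¹ b h ∈ Kf}`, at every finite place `w` a valuation bound `|S_{ab}|_w ≤ q_w^{m}` with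
`q_w^{m} ≤ q_w^{δ_w} · H_w(h)^k` (`δ = 0` off `T_δ`; payer (P-supp-lat) from (ρ3)(ρ5) + ★ (c1)).  THEN `∃ Cb κb, 0 < Cb ∧ 0 ≤ κb ∧` for all `S, s, h` with `n∕2 < re s`:
if the TOP's normalised middle-cell term (the left-hand side of ★ p863141's `hpin`, byte for byte) is `≠ 0`, there is `D : ℕ`, `1 ≤ D ≤ Cb · H(h)^κb`, with `D · S` integral —
the (supp½) letter of ★ p863141 once `E` is the pinned term (§2 + `hlat` feed ★ `hsupp_of_local`; `Cb = (∏_{w ∈ T_δ} q_w^{δ_w}) · (n+n)^k`, `κb = k`).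
[cite: MoeglinWaldspurger1995, I.2.6, II.1.7] [cite: Shimura1997, §18.4 Prop. 18.14] [cite: KudlaRallis1994, §2] -/
theorem hsupp_middle_of_letters (hn : 0 < n) (hdV0 : ∀ i, dV i ≠ 0) (hdW0 : ∀ i, dW i ≠ 0)
    {χ : HeckeCharacter L} (hχ : χ.IsUnitary)
    {f : ℂ → HA L e dV hdV dW hdW → ℂ} (hfΔ : ∀ s, IsSiegelDeltaSection L e dV hdV dW hdW χ s (f s)) (hfc : ∀ s, Continuous (f s))
    (νN : Measure (unipDelta L e dV hdV dW hdW)) [νN.IsMulLeftInvariant]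
    {β : unipDelta L e dV hdV dW hdW → ℝ≥0∞} (hβ : IsCoveringWeight (unipDeltaRat L e dV hdV dW hdW) β) (hβtop : ∫⁻ u, β u ∂νN ≠ ∞)
    {K : Set (unipDelta L e dV hdV dW hdW)} (hK : IsCompact K) (hβK : ∀ u, β u ≤ K.indicator 1 u)
    (wq : unipDeltaRat L e dV hdV dW hdW → ratH L e dV hdV dW hdW)
    -- (ρ7) the level of the family, uniform in `s` (by value)
    (Kf : Subgroup (HA L e dV hdV dW hdW)) (hKf : ∀ (s : ℂ) (x k : HA L e dV hdV dW hdW), k ∈ Kf → f s (x * k) = f s x)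
    -- (ρ8) the `REST`-cell sum is left-`N_Δ(L⁺)`-invariant (by value)
    (hrestL : ∀ (s : ℂ) (γ : unipDeltaRat L e dV hdV dW hdW) (x : HA L e dV hdV dW hdW),
      (∑' q : ↥(({Quotient.mk (MulAction.orbitRel (siegelDeltaRat L e dV hdV dW hdW) (ratH L e dV hdV dW hdW)) 1} ∪
            Set.range (fun ν : unipDeltaRat L e dV hdV dW hdW =>
              (Quotient.mk (MulAction.orbitRel (siegelDeltaRat L e dV hdV dW hdW) (ratH L e dV hdV dW hdW)) (wq ν) :
                SiegelDeltaQuot L e dV hdV dW hdW)))ᶜ : Set (SiegelDeltaQuot L e dV hdV dW hdW)),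
          f s ((((Quotient.out (q : SiegelDeltaQuot L e dV hdV dW hdW) : ratH L e dV hdV dW hdW) : HA L e dV hdV dW hdW)) *
            ((((γ : unipDelta L e dV hdV dW hdW)) : HA L e dV hdV dW hdW) * x))) =
        ∑' q : ↥(({Quotient.mk (MulAction.orbitRel (siegelDeltaRat L e dV hdV dW hdW) (ratH L e dV hdV dW hdW)) 1} ∪
            Set.range (fun ν : unipDeltaRat L e dV hdV dW hdW =>
              (Quotient.mk (MulAction.orbitRel (siegelDeltaRat L e dV hdV dW hdW) (ratH L e dV hdV dW hdW)) (wq ν) :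
                SiegelDeltaQuot L e dV hdV dW hdW)))ᶜ : Set (SiegelDeltaQuot L e dV hdV dW hdW)),
          f s ((((Quotient.out (q : SiegelDeltaQuot L e dV hdV dW hdW) : ratH L e dV hdV dW hdW) : HA L e dV hdV dW hdW)) * x))
    -- (P-supp-lat) the lattice letters (by value)
    (Tδ : Finset (HeightOneSpectrum (𝓞 L))) (δ : HeightOneSpectrum (𝓞 L) → ℕ) (hδ : ∀ w ∉ Tδ, δ w = 0) (k : ℕ)
    (hlat : ∀ (S : skewMatrices ((IsCMField.complexConj L : L ≃ₐ[Fp L] L) : L →+* L) ((gramR L e dV hdV dW hdW).map (algebraMap (Fp L) L)))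
      (h : HA L e dV hdV dW hdW),
      (∀ b : unipDelta L e dV hdV dW hdW, h⁻¹ * (b : HA L e dV hdV dW hdW) * h ∈ Kf →
        unipDeltaChar L e dV hdV dW hdW (S : Matrix (Fin n) (Fin n) L) (b : HA L e dV hdV dW hdW) = 1) →
      ∀ w : HeightOneSpectrum (𝓞 L), ∃ m : ℕ,
        ((Ideal.absNorm w.asIdeal : ℕ) : ℝ) ^ m ≤
            ((Ideal.absNorm w.asIdeal : ℕ) : ℝ) ^ δ w * (GLn.localHeight (n + n) L w (h : GL (Fin (n + n)) (AdeleRing (𝓞 L) L)) : ℝ) ^ k ∧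
          ∀ a b, Valued.v ((((S : Matrix (Fin n) (Fin n) L) a b : L)) : w.adicCompletion L) ≤ WithZero.exp (m : ℤ)) :
    ∃ Cb κb : ℝ, 0 < Cb ∧ 0 ≤ κb ∧
      ∀ (S : skewMatrices ((IsCMField.complexConj L : L ≃ₐ[Fp L] L) : L →+* L) ((gramR L e dV hdV dW hdW).map (algebraMap (Fp L) L)))
        (s : ℂ) (h : HA L e dV hdV dW hdW), (n : ℝ) / 2 < s.re →
        ((∫⁻ u, β u ∂νN).toReal⁻¹ : ℝ) •
          (∫ u, (β u).toReal • (conj (unipDeltaChar L e dV hdV dW hdW (S : Matrix (Fin n) (Fin n) L) (u : HA L e dV hdV dW hdW) : ℂ) *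
            (∑' q : ↥(({Quotient.mk (MulAction.orbitRel (siegelDeltaRat L e dV hdV dW hdW) (ratH L e dV hdV dW hdW)) 1} ∪
              Set.range (fun ν : unipDeltaRat L e dV hdV dW hdW =>
                (Quotient.mk (MulAction.orbitRel (siegelDeltaRat L e dV hdV dW hdW) (ratH L e dV hdV dW hdW)) (wq ν) :
                  SiegelDeltaQuot L e dV hdV dW hdW)))ᶜ : Set (SiegelDeltaQuot L e dV hdV dW hdW)),
              f s ((((Quotient.out (q : SiegelDeltaQuot L e dV hdV dW hdW) : ratH L e dV hdV dW hdW) : HA L e dV hdV dW hdW)) *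
                ((u : HA L e dV hdV dW hdW) * h)))) ∂νN) ≠ 0 →
        ∃ D : ℕ, 1 ≤ D ∧ (D : ℝ) ≤ Cb * adelicHeightGL (n + n) L (h : GL (Fin (n + n)) (AdeleRing (𝓞 L) L)) ^ κb ∧
          ∀ i j, IsIntegral ℤ ((D : L) * (S : Matrix (Fin n) (Fin n) L) i j) := by
  classical
  haveI : NeZero (n + n) := ⟨by omega⟩
  have hn0 : (0 : ℝ) ≤ (n : ℝ) / 2 := by positivity
  -- the `T`-part `A S s h :=` the normalised middle-cell term on `{n∕2 < re s}`, `0` elsewhere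
  obtain ⟨Cb, κb, hCb, hκb, hmain⟩ := hsupp_of_local L (N := n + n)
    (mat := fun S : skewMatrices ((IsCMField.complexConj L : L ≃ₐ[Fp L] L) : L →+* L) ((gramR L e dV hdV dW hdW).map (algebraMap (Fp L) L)) =>
      (S : Matrix (Fin n) (Fin n) L))
    (ht := fun h : HA L e dV hdV dW hdW => (h : GL (Fin (n + n)) (AdeleRing (𝓞 L) L)))
    (A := fun S s h => if (n : ℝ) / 2 < s.re then
      fourierCoeffDelta L e dV hdV dW hdW νN β (S : Matrix (Fin n) (Fin n) L)
        (fun x => ∑' q : ↥(({Quotient.mk (MulAction.orbitRel (siegelDeltaRat L e dV hdV dW hdW) (ratH L e dV hdV dW hdW)) 1} ∪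
              Set.range (fun ν : unipDeltaRat L e dV hdV dW hdW =>
                (Quotient.mk (MulAction.orbitRel (siegelDeltaRat L e dV hdV dW hdW) (ratH L e dV hdV dW hdW)) (wq ν) :
                  SiegelDeltaQuot L e dV hdV dW hdW)))ᶜ : Set (SiegelDeltaQuot L e dV hdV dW hdW)),
            f s ((((Quotient.out (q : SiegelDeltaQuot L e dV hdV dW hdW) : ratH L e dV hdV dW hdW) : HA L e dV hdV dW hdW)) * x)) h
      else 0)
    Tδ δ hδ k (by
      -- `hloc`: §2 + the lattice letter
      intro S s h _ hA w
      by_cases hs : (n : ℝ) / 2 < s.re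
      · simp only [if_pos hs] at hA
        exact hlat S h (fun b hb => unipDeltaChar_eq_one_of_coeff_ne_zero L e dV hdV dW hdW hdV0 hdW0 hχ hs (hfΔ s) (hfc s) νN hβ hβtop hK hβK wq
          Kf (hKf s) (hrestL s) (S : Matrix (Fin n) (Fin n) L) h hA b hb) w
      · simp only [if_neg hs, ne_eq, not_true_eq_false] at hA)
  refine ⟨Cb, κb, hCb, hκb, fun S s h hs hMID => hmain S s h (lt_of_le_of_lt hn0 hs) ?_⟩
  simpa only [if_pos hs, fourierCoeffDelta_def] using hMID

end Summit.HodgeConjecture.HodgeConjecture.Cruxes.HLiu418.K2LiuKindOneLineSupportIntrinsic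

end
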